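import Summits.Ventures.PercRepro.S2RowFifteenOpenOne
import Summits.Ventures.PercRepro.S2FifteenSixFull

/-!
# PercRepro — S2: THEOREM C₅ AT `16` — UNCONDITIONAL (p7, gen 12; sub-claim S2; the `p = 15` row complete)

The `p = 15` row of the level-`5` window is a tree theorem at every corank: `d ≤ 5` by the kit's reduction, `d = 6` (S2FifteenSixFull),
`d = 7` (S2FifteenSeven), `d = 8, 9` (the flat count, g11), `d = 10 … 14, 16` (the concentrated tail), `d = 15` (the nested dichotomy, g11),
`d ≥ 17` (the plain and key cells, g11). Hence **`c025_five_large_sharp16 (M) [M.Finite] (p) (hp : 16 ≤ p) : RLS M p 5`** —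
C-025 at level `5` for every `p ≥ 16`, on the level-`4` row from `11` (S1's `c025_four_sixteen`) through `c025_five_large_sharp16_of_one_cell`.
The window of the sub-claim S2 becomes «`8 ≤ p ≤ 15`» (the lead's addendum of record). Axioms: standard.
-/

open scoped Matroid

namespace PercRepro

namespace ThmN

variable {α : Type}

/-- **THEOREM C₅ AT `16`**: C-025 at level `5` for every rank `p ≥ 16`, unconditionally. -/
theorem c025_five_large_sharp16 (M : Matroid α) [M.Finite] (p : ℕ) (hp : 16 ≤ p) : RLS M p 5 :=
  c025_five_large_sharp16_of_one_cell (fun M _ hR hn hfree => c025_core_five_fifteen_six M hR hn hfree) M p hp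

end ThmN

end PercRepro
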